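/-
COR-CM (cell pub-hodgecm2, stage 2 of the Hodge ladder) — count-neutral KERNEL COMBINATORICS «the order-16 dispatch», part III: the two BRICKS in element
form — dihedral quotient data from three elements `(n′, u, w)`, a quaternion pair from two elements `(i, j)` with `i j = c · j i` (seat
prover-pub-hodgecm2-b23-g55-0, binder prover b23, gen 55; claim HOME/INBOX.md l.25631).  Theorems only; seat b23 gen 54ʼs
`QuaternionDoubling.isLeast_card_gfaces_generate_fibreTwo_of_dihedral_quotient_data` (= seat b09 gen 46ʼs dihedral kernel-two law) and
`…_of_quaternion_pair` BY NAME; no `decide`, no certificate, no named fact, no `sorry`.  `Interfaces.lean` (C1), every E term, B01, `Transposition/*`,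
`PortJoin/*`, `D2Bridge/*` untouched.
HONEST FRAMING: `HC_CM` is NOT proved, here or anywhere in the tree; nothing here is a period, a count of record or a headline.
T5: n/a-class (hypothesis binders: `|G| = 16`, `c` a central involution, `n′` a second central involution, `u w ≠ w u`, `u² ∈ {c, c n′}`, `w², (wu)² ∈ {1, n′}`
— inhabited by `D₄ × ℤ/2` (`c = r²`, `n′ = x`, `u = r`, `w = s`), `ℤ/4 ⋊ ℤ/4`, `G(16,3)`; resp. `i² = j² = c`, `i j = c j i` — inhabited by `Q₈ × ℤ/2`, Pauli);
checker: self.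
-/
import Summits.HodgeConjecture.CorCM.Census.OrderSixteenCommutator
import Summits.HodgeConjecture.CorCM.Census.QuaternionDoublingDihedralEquiv

/-!
# The order-16 dispatch, III: the two bricks in element form

* §1 **`isLeast_of_dihedral_elements`**: `|G| = 16`, `c` a central involution, `n′ ∉ {1, c}` a central involution, `u, w` with `u w ≠ w u`,
  `u² ∈ {c, c n′}`, `w² ∈ {1, n′}`, `(w u)² ∈ {1, n′}` ⟹ **`μ(G, c) = φ₂(G, c)`**: in `G ⧸ ⟨n′⟩` the images `ū, w̄` are a dihedral presentation of
  order `8` (`ū` of order `4` and index `2`, `w̄` an involution outside `⟨ū⟩` inverting `ū`) with `c̄ = ū²` — seat b23 gen 54ʼs quotient-data brick,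
  i.e. seat b09 gen 46ʼs dihedral kernel-two law.
* §2 **`isLeast_of_quaternion_elements`**: `|G| = 16`, `c ≠ 1` central, `i² = j² = c`, `i j = c · j i` ⟹ **`μ(G, c) = φ₂(G, c)`** — `(i, j)` is a
  quaternion pair (seat b23 gen 54ʼs `…_of_quaternion_pair`).
All [folklore].

## References
* [Pohlmann1968] H. Pohlmann, Algebraic cycles on abelian varieties of complex multiplication type, Ann. of Math. 88 (1968), Thm 1.
-/

namespace Summit.HodgeConjecture.CorCM.Census.OrderSixteen

open Subgroup
open Summit.HodgeConjecture.CorCM.Prior.AllgGroup.RfwfAllgGroup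
open Summit.HodgeConjecture.CorCM.Census.BlockParity
open Summit.HodgeConjecture.CorCM.Census.Coinvariant

noncomputable section

variable {G : Type*} [Group G] [Fintype G] [DecidableEq G] {c : G}

/-! ## §1 Dihedral quotient data from three elements -/

/-- **DIHEDRAL QUOTIENT DATA IN ELEMENT FORM ⟹ `μ(G, c) = φ₂(G, c)`.**  `|G| = 16`; `c` a central involution; `n′ ∉ {1, c}` a central involution;
`u w ≠ w u`; `u² ∈ {c, c n′}`; `w² ∈ {1, n′}`; `(w u)² ∈ {1, n′}`.  Then `G ↠ G ⧸ ⟨n′⟩ ≅ D₄` with kernel of order `2` sends `c` to `r²`: seat b23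
gen 54ʼs `QuaternionDoubling.isLeast_card_gfaces_generate_fibreTwo_of_dihedral_quotient_data` (seat b09 gen 46ʼs kernel-two law). [folklore] -/
theorem isLeast_of_dihedral_elements (hG : Nat.card G = 16) (hc2 : c * c = 1) (hc1 : c ≠ 1) (hcen : ∀ x : G, x * c = c * x)
    {n u w : G} (hncen : ∀ x : G, x * n = n * x) (hnn : n * n = 1) (hn1 : n ≠ 1) (hnc : n ≠ c) (huw : u * w ≠ w * u)
    (hu : u * u = c ∨ u * u = c * n) (hw : w * w = 1 ∨ w * w = n) (hwu : w * u * (w * u) = 1 ∨ w * u * (w * u) = n) :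
    IsLeast {m : ℕ | ∃ S : Finset (CMF G c →₀ ℤ), (↑S ⊆ gfaceSet G c hc2) ∧ S.card = m ∧
      hodgeSpan c hc2 ≤ Submodule.span ℤ (pairSet c) ⊔ Submodule.span ℤ (translates c S)} (fibreTwo c hc2) := by
  classical
  let N : Subgroup G := zpowers n
  have hnZ : n ∈ center G := mem_center_iff.mpr hncen
  have hNZ : N ≤ center G := zpowers_le.mpr hnZ
  haveI : N.Normal := ⟨fun x hx g => by
    have hxc := mem_center_iff.mp (hNZ hx) g
    rw [hxc, mul_inv_cancel_right]; exact hx⟩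
  -- `|N| = 2`, `|G ⧸ N| = 8`
  have hordn : orderOf n = 2 := orderOf_eq_prime (by rw [pow_two, hnn]) hn1
  have hN : Nat.card N = 2 := by rw [Nat.card_zpowers, hordn]
  have hq : Nat.card (G ⧸ N) = 8 := by
    have h := Subgroup.card_eq_card_quotient_mul_card_subgroup N
    rw [hG, hN] at h; omega
  -- the elements of `N` are `1` and `n`, all central; `c ∉ N`
  have hNmem : ∀ {t : G}, t ∈ N → t = 1 ∨ t = n := fun {t} ht => eq_one_or_eq_of_card_two N hN (mem_zpowers n) hn1 ht
  have hcN : (QuotientGroup.mk c : G ⧸ N) ≠ 1 := by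
    intro h
    rw [QuotientGroup.eq_one_iff] at h
    rcases hNmem h with e | e
    · exact hc1 e
    · exact hnc e.symm
  have hnN : (QuotientGroup.mk n : G ⧸ N) = 1 := (QuotientGroup.eq_one_iff n).mpr (mem_zpowers n)
  -- the images
  set ub : G ⧸ N := QuotientGroup.mk u with hub
  set wb : G ⧸ N := QuotientGroup.mk w with hwb
  have hmk : ∀ x y : G, (QuotientGroup.mk (x * y) : G ⧸ N) = QuotientGroup.mk x * QuotientGroup.mk y := fun x y => rfl
  have hub2 : ub ^ 2 = QuotientGroup.mk c := by
    rw [pow_two, hub, ← hmk]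
    rcases hu with e | e
    · rw [e]
    · rw [e, hmk, hnN, mul_one]
  have hub4 : ub ^ 4 = 1 := by
    rw [show (4 : ℕ) = 2 * 2 by norm_num, pow_mul, hub2, pow_two, ← hmk, hc2]; rfl
  have hord : orderOf ub = 4 := by
    have h := orderOf_eq_prime_pow (p := 2) (n := 1) (x := ub) (by simpa [hub2] using hcN) (by simpa using hub4)
    simpa using h
  have hindex : (zpowers ub).index = 2 := by
    have h := (zpowers ub).card_mul_index
    rw [Nat.card_zpowers, hord, hq] at h
    omega
  have hww : wb * wb = 1 := by
    rw [hwb, ← hmk]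
    rcases hw with e | e
    · rw [e]; rfl
    · rw [e, hnN]
  have hwuwu : wb * ub * (wb * ub) = 1 := by
    rw [hwb, hub, ← hmk, ← hmk]
    rcases hwu with e | e
    · rw [e]; rfl
    · rw [e, hnN]
  have hwinv : wb⁻¹ = wb := inv_eq_of_mul_eq_one_right hww
  have hwu' : wb * ub * wb⁻¹ = ub⁻¹ := by
    rw [hwinv]
    exact eq_inv_of_mul_eq_one_left (by rw [← mul_assoc] at hwuwu; exact hwuwu)
  have hwout : wb ∉ zpowers ub := by
    intro h
    have h' : wb ∈ Submonoid.powers ub := ((isOfFinOrder_of_finite ub).mem_powers_iff_mem_zpowers).mpr h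
    obtain ⟨k, hk⟩ := (Submonoid.mem_powers_iff _ _).mp h'
    rw [hub, hwb, ← QuotientGroup.mk_pow, QuotientGroup.eq] at hk
    -- `w = u^k z` with `z` central
    have hzc := mem_center_iff.mp (hNZ hk)
    apply huw
    have hw' : w = u ^ k * ((u ^ k)⁻¹ * w) := by rw [mul_inv_cancel_left]
    calc u * w = u * (u ^ k * ((u ^ k)⁻¹ * w)) := by rw [← hw']
      _ = u ^ k * (u * ((u ^ k)⁻¹ * w)) := by rw [← mul_assoc, ← pow_succ', pow_succ, mul_assoc]
      _ = u ^ k * (((u ^ k)⁻¹ * w) * u) := by rw [hzc u]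
      _ = (u ^ k * ((u ^ k)⁻¹ * w)) * u := by simp only [mul_assoc]
      _ = w * u := by rw [← hw']
  exact QuaternionDoubling.isLeast_card_gfaces_generate_fibreTwo_of_dihedral_quotient_data hc2 hcen N hN ub wb hord hindex hwout hww
    hwu' hub2.symm

/-! ## §2 A quaternion pair from two elements -/

/-- **A QUATERNION PAIR IN ELEMENT FORM ⟹ `μ(G, c) = φ₂(G, c)`.**  `|G| = 16`; `c ≠ 1` central; `i² = j² = c`; `i j = c · j i`.  Then `i` has order
`4`, `j i j⁻¹ = i⁻¹`, `j ∉ ⟨i⟩`: seat b23 gen 54ʼs `QuaternionDoubling.isLeast_card_gfaces_generate_fibreTwo_of_quaternion_pair`. [folklore] -/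
theorem isLeast_of_quaternion_elements (hG : Nat.card G = 16) (hc2 : c * c = 1) (hc1 : c ≠ 1) (hcen : ∀ x : G, x * c = c * x)
    {i j : G} (hii : i * i = c) (hjj : j * j = c) (hij : i * j = c * (j * i)) :
    IsLeast {m : ℕ | ∃ S : Finset (CMF G c →₀ ℤ), (↑S ⊆ gfaceSet G c hc2) ∧ S.card = m ∧
      hodgeSpan c hc2 ≤ Submodule.span ℤ (pairSet c) ⊔ Submodule.span ℤ (translates c S)} (fibreTwo c hc2) := by
  haveI : Fact (Nat.Prime 2) := ⟨Nat.prime_two⟩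
  have hord : orderOf i = 4 := by
    have h := orderOf_eq_prime_pow (p := 2) (n := 1) (x := i) (by rw [pow_one, pow_two, hii]; exact hc1)
      (by rw [show 2 ^ (1 + 1) = 2 * 2 by norm_num, pow_mul, pow_two i, hii, pow_two, hc2])
    simpa using h
  have hiinv : i⁻¹ = c * i := by
    apply inv_eq_of_mul_eq_one_right
    rw [← mul_assoc, hcen i, mul_assoc, hii, hc2]
  have hji : j * i * j⁻¹ = i⁻¹ := by
    rw [mul_inv_eq_iff_eq_mul, hiinv, mul_assoc, hij, ← mul_assoc, hc2, one_mul]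
  have hj : j ∉ zpowers i := by
    intro h
    have h' : j ∈ Submonoid.powers i := ((isOfFinOrder_of_finite i).mem_powers_iff_mem_zpowers).mpr h
    obtain ⟨k, hk⟩ := (Submonoid.mem_powers_iff _ _).mp h'
    have hcomm : i * j = j * i := by rw [← hk, ← pow_succ', pow_succ]
    rw [hcomm] at hij
    exact hc1 (mul_right_cancel (a := 1) (by rw [one_mul]; exact hij)).symm
  exact QuaternionDoubling.isLeast_card_gfaces_generate_fibreTwo_of_quaternion_pair hG hcen i j hord hii hjj hji hj hc2

end

end Summit.HodgeConjecture.CorCM.Census.OrderSixteen
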